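import Summits.MatrixMultiplication.OmegaCensus.DicyclicSubgroupRestriction
import HarnessLib

/-!
# Restriction to an index-two subgroup, II: quotients without a cyclic subgroup of index `≤ 2`

ω-census `pub-omega`, family (b3), seat pub-omega-group gen 13.  Framing: lottery ticket; floor = certified bounds/negative
ranges.  VALUE: a kernel tool for the successor (quotients `A/⟨c₀⟩` of `2`-rank `2`); NOT progress on ω.

`no_dicyclic_law_of_two_small` (`DicyclicSubgroupRestriction.lean`) uses the three characters onto `𝔽₂³` only in its last line
(`psi_not_onto_of_four_cosets`).  Here the conclusion of the restriction — `A` is covered by the four cosets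
`{0, z, c₀, c₀ − z} + ⟨g⟩`, i.e. `A/⟨c₀⟩` has a cyclic subgroup of index `≤ 2` — is negated directly as hypothesis `h4`, so the
theorem applies to ALL quotients without a cyclic subgroup of index `≤ 2` (`ℤ₄ × ℤ₁₆`, `ℤ₈²`, `ℤ₅ × ℤ₂₀`, …, the open cells of
`2`-rank `2`): `no_dicyclic_law_of_two_small'`.  Corollary `no_dicyclic_law_of_two_domino_rank_two`: with TWO homomorphisms
`A →+ ZMod 2` killing `c₀` and jointly onto `𝔽₂²`, no two-domino triple attains the dicyclic law in such a group (class P1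
for `2`-rank `2`).
-/

namespace Summit.MatrixMultiplication.OmegaCensus

open Literature.Combinatorics.Additive Finset

section Restriction

variable {A : Type} [AddCommGroup A] [DecidableEq A] [Fintype A] {G : Type} [Group G] [DecidableEq G]
  {ρ τ : A → G} {c₀ : A}

/-- **Restriction to an index-two subgroup kills the dicyclic law, `A/⟨c₀⟩` without a cyclic subgroup of index `≤ 2`**
(hypothesis `h4`: `A` is not covered by four cosets `{0, z, c₀, c₀ − z} + ⟨g⟩`; see `DicyclicSubgroupRestriction.lean`):
dicyclic type, `c₀ ≠ 0`, `|A| ≡ 2 (mod 3)`, `|A| ≥ 28`; a TPP triple attaining `3|S||T||U| + 16 = 8|A|`; `φ : A →+ ZMod 2` non-zero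
with `φ c₀ = 0`, constant `e` on `S₀`, `e + φ x` on `S₁`, `f` on `U₀`, `f + φ x` on `U₁` (so `S` and `U` lie in right
cosets of `H = ρ(ker φ) ∪ τ(x + ker φ)`).  Then `False`. [folklore] -/
theorem no_dicyclic_law_of_two_small'
    (hρρ : ∀ a b, ρ a * ρ b = ρ (a + b)) (hρτ : ∀ a b, ρ a * τ b = τ (b - a))
    (hτρ : ∀ a b, τ a * ρ b = τ (a + b)) (hττ : ∀ a b, τ a * τ b = ρ (c₀ + b - a)) (hc₀ : c₀ ≠ 0)
    (hρ : Function.Injective ρ) (hτ : Function.Injective τ) (hne : ∀ a b, ρ a ≠ τ b)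
    (hsurj : ∀ g, (∃ a, ρ a = g) ∨ (∃ a, τ a = g)) (hmod : Fintype.card A % 3 = 2) (hA : 28 ≤ Fintype.card A)
    (h4 : ∀ g z : A, ¬ ∀ y : A, y ∈ AddSubgroup.zmultiples g ∨ y - z ∈ AddSubgroup.zmultiples g ∨
      y + c₀ ∈ AddSubgroup.zmultiples g ∨ y + c₀ - z ∈ AddSubgroup.zmultiples g)
    {S T U : Finset G} (h : TripleProductProperty S T U)
    (hV : 3 * (S.card * T.card * U.card) + 16 = 8 * Fintype.card A)
    (φ : A →+ ZMod 2) (hφc : φ c₀ = 0) (hφ : ∃ a, φ a ≠ 0) (x : A) (e f : ZMod 2)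
    (hS₀ : ∀ a, ρ a ∈ S → φ a = e) (hS₁ : ∀ a, τ a ∈ S → φ a = e + φ x)
    (hU₀ : ∀ a, ρ a ∈ U → φ a = f) (hU₁ : ∀ a, τ a ∈ U → φ a = f + φ x) : False := by
  classical
  have zmod2_eq_one_of_ne_zero : ∀ {z : ZMod 2}, z ≠ 0 → z = 1 := by decide
  -- `φ` is onto; an element `a₁` with `φ a₁ = 1`, and preimages of `e`, `f`
  obtain ⟨a₁, ha₁'⟩ := hφ
  have ha₁ : φ a₁ = 1 := zmod2_eq_one_of_ne_zero ha₁'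
  have hφsurj : Function.Surjective φ := by
    intro v
    by_cases hv : v = 0
    · exact ⟨0, by rw [map_zero, hv]⟩
    · exact ⟨a₁, by rw [ha₁, zmod2_eq_one_of_ne_zero hv]⟩
  obtain ⟨aₑ, haₑ⟩ := hφsurj e
  obtain ⟨a_f, ha_f⟩ := hφsurj f
  -- the subgroup `H`
  obtain ⟨H, hH⟩ := exists_subgroup_of_hom hρρ hρτ hτρ hττ φ hφc x
  -- `S·ρ(−aₑ) ⊆ H`, `U·ρ(−a_f) ⊆ H`
  have hSH : ∀ g ∈ S.map (Equiv.mulRight (ρ (-aₑ))).toEmbedding, g ∈ H := by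
    intro g hg
    rw [mem_map_mulRight_iff, inv_rho hρρ, neg_neg] at hg
    have eg : g = g * ρ aₑ * ρ (-aₑ) := by rw [mul_assoc, hρρ, add_neg_cancel, rho_zero hρρ, mul_one]
    rcases hsurj (g * ρ aₑ) with ⟨a, ha⟩ | ⟨a, ha⟩
    · rw [← ha] at hg
      refine (hH g).2 ⟨a + -aₑ, by rw [map_add, map_neg, hS₀ a hg, haₑ, add_neg_cancel], Or.inl ?_⟩
      rw [eg, ← ha, hρρ]
    · rw [← ha] at hg
      refine (hH g).2 ⟨a + -aₑ - x, ?_, Or.inr ?_⟩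
      · rw [map_sub, map_add, map_neg, hS₁ a hg, haₑ]; abel
      · rw [eg, ← ha, hτρ]; congr 1; abel
  have hUH : ∀ g ∈ U.map (Equiv.mulRight (ρ (-a_f))).toEmbedding, g ∈ H := by
    intro g hg
    rw [mem_map_mulRight_iff, inv_rho hρρ, neg_neg] at hg
    have eg : g = g * ρ a_f * ρ (-a_f) := by rw [mul_assoc, hρρ, add_neg_cancel, rho_zero hρρ, mul_one]
    rcases hsurj (g * ρ a_f) with ⟨a, ha⟩ | ⟨a, ha⟩
    · rw [← ha] at hg
      refine (hH g).2 ⟨a + -a_f, by rw [map_add, map_neg, hU₀ a hg, ha_f, add_neg_cancel], Or.inl ?_⟩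
      rw [eg, ← ha, hρρ]
    · rw [← ha] at hg
      refine (hH g).2 ⟨a + -a_f - x, ?_, Or.inr ?_⟩
      · rw [map_sub, map_add, map_neg, hU₁ a hg, ha_f]; abel
      · rw [eg, ← ha, hτρ]; congr 1; abel
  -- an element outside `H` is moved into `H` by `ρ(−a₁)`
  have hmove : ∀ g : G, g ∉ H → g * ρ (-a₁) ∈ H := by
    intro g hg
    rcases hsurj g with ⟨a, rfl⟩ | ⟨a, rfl⟩
    · have hφa : φ a = 1 := by
        apply zmod2_eq_one_of_ne_zero
        intro h0
        exact hg ((hH _).2 ⟨a, h0, Or.inl rfl⟩)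
      refine (hH _).2 ⟨a + -a₁, by rw [map_add, map_neg, hφa, ha₁, add_neg_cancel], Or.inl ?_⟩
      rw [hρρ]
    · have hφa : φ (a - x) = 1 := by
        apply zmod2_eq_one_of_ne_zero
        intro h0
        exact hg ((hH _).2 ⟨a - x, h0, Or.inr (by congr 1; abel)⟩)
      refine (hH _).2 ⟨a - x + -a₁, by rw [map_add, map_neg, hφa, ha₁, add_neg_cancel], Or.inr ?_⟩
      rw [hτρ]; congr 1; abel
  -- the larger half of `T`, translated into `H`
  obtain ⟨T₀, r, hT₀T, hT₀card, hT₀H⟩ :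
      ∃ (T₀ : Finset G) (r : G), T₀ ⊆ T ∧ T.card ≤ 2 * T₀.card ∧ ∀ g ∈ T₀, g * r ∈ H := by
    have hsplit := Finset.card_filter_add_card_filter_not (s := T) (fun g => g ∈ H)
    by_cases hbig : T.card ≤ 2 * (T.filter fun g => g ∈ H).card
    · refine ⟨T.filter fun g => g ∈ H, 1, filter_subset _ _, hbig, fun g hg => ?_⟩
      rw [mul_one]; exact (mem_filter.1 hg).2
    · refine ⟨T.filter fun g => ¬ g ∈ H, ρ (-a₁), filter_subset _ _, by omega, fun g hg => ?_⟩
      exact hmove g (mem_filter.1 hg).2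
  -- the translated triple inside `H`
  set S' := S.map (Equiv.mulRight (ρ (-aₑ))).toEmbedding with hS'
  set T' := T₀.map (Equiv.mulRight r).toEmbedding with hT'
  set U' := U.map (Equiv.mulRight (ρ (-a_f))).toEmbedding with hU'
  have hT'H : ∀ g ∈ T', g ∈ H := by
    intro g hg
    rw [hT', mem_map_mulRight_iff] at hg
    have := hT₀H _ hg
    rwa [inv_mul_cancel_right] at this
  have htpp' : TripleProductProperty S' T' U' := (h.mono (Subset.refl _) hT₀T (Subset.refl _)).map_mulRight _ _ _
  -- inside the group `H`
  set S'' : Finset H := S'.subtype (· ∈ H) with hS''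
  set T'' : Finset H := T'.subtype (· ∈ H) with hT''
  set U'' : Finset H := U'.subtype (· ∈ H) with hU''
  have htpp'' : TripleProductProperty S'' T'' U'' := tpp_subtype H htpp'
  have cS'' : S''.card = S.card := by rw [hS'', card_subtype_of_subset H hSH, hS', card_map]
  have cT'' : T''.card = T₀.card := by rw [hT'', card_subtype_of_subset H hT'H, hT', card_map]
  have cU'' : U''.card = U.card := by rw [hU'', card_subtype_of_subset H hUH, hU', card_map]
  -- the presentation of `H` over `A' = ker φ`
  set A' : AddSubgroup A := φ.ker with hA'
  have hc₀' : c₀ ∈ A' := by rw [hA', AddMonoidHom.mem_ker]; exact hφc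
  set c₀' : A' := ⟨c₀, hc₀'⟩ with hc₀'def
  have memA' : ∀ a : A', φ (a : A) = 0 := fun a => (AddMonoidHom.mem_ker).1 a.2
  set ρ' : A' → H := fun a => ⟨ρ a, (hH _).2 ⟨a, memA' a, Or.inl rfl⟩⟩ with hρ'def
  set τ' : A' → H := fun a => ⟨τ (x + a), (hH _).2 ⟨a, memA' a, Or.inr rfl⟩⟩ with hτ'def
  have hρρ' : ∀ a b, ρ' a * ρ' b = ρ' (a + b) := fun a b => by
    apply Subtype.ext
    show ρ (a : A) * ρ (b : A) = ρ ((a + b : A') : A)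
    rw [hρρ, AddSubgroup.coe_add]
  have hρτ' : ∀ a b, ρ' a * τ' b = τ' (b - a) := fun a b => by
    apply Subtype.ext
    show ρ (a : A) * τ (x + (b : A)) = τ (x + ((b - a : A') : A))
    rw [hρτ, AddSubgroup.coe_sub]; congr 1; abel
  have hτρ' : ∀ a b, τ' a * ρ' b = τ' (a + b) := fun a b => by
    apply Subtype.ext
    show τ (x + (a : A)) * ρ (b : A) = τ (x + ((a + b : A') : A))
    rw [hτρ, AddSubgroup.coe_add]; congr 1; abel
  have hττ' : ∀ a b, τ' a * τ' b = ρ' (c₀' + b - a) := fun a b => by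
    apply Subtype.ext
    show τ (x + (a : A)) * τ (x + (b : A)) = ρ (((c₀' + b - a : A') : A))
    rw [hττ, AddSubgroup.coe_sub, AddSubgroup.coe_add]; congr 1
    show c₀ + (x + (b : A)) - (x + (a : A)) = c₀ + (b : A) - (a : A)
    abel
  have hρ'inj : Function.Injective ρ' := fun a b hab => by
    apply Subtype.ext
    exact hρ (congrArg Subtype.val hab)
  have hτ'inj : Function.Injective τ' := fun a b hab => by
    apply Subtype.ext
    have := hτ (congrArg Subtype.val hab)
    exact add_left_cancel this
  have hne' : ∀ a b, ρ' a ≠ τ' b := fun a b hab => hne _ _ (congrArg Subtype.val hab)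
  have hsurj' : ∀ g : H, (∃ a, ρ' a = g) ∨ (∃ a, τ' a = g) := by
    intro g
    obtain ⟨a, ha, hg⟩ := (hH g).1 g.2
    have haA' : a ∈ A' := by rw [hA', AddMonoidHom.mem_ker]; exact ha
    rcases hg with hg | hg
    · exact Or.inl ⟨⟨a, haA'⟩, Subtype.ext hg.symm⟩
    · exact Or.inr ⟨⟨a, haA'⟩, Subtype.ext hg.symm⟩
  have hc₀'ne : c₀' ≠ 0 := fun h0 => hc₀ (congrArg Subtype.val h0)
  -- `|A'| = |A|/2`
  have hcardA' : 2 * Fintype.card A' = Fintype.card A := by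
    have h1 := DihedralLikeGroup.card_ker_mul_card φ hφsurj
    rw [ZMod.card] at h1
    have h2 : Fintype.card A' = (univ.filter fun a : A => φ a = 0).card := by
      have : Fintype.card A' = (univ.filter fun a : A => a ∈ A').card := by convert Fintype.card_subtype _
      rw [this]
      congr 1
      apply filter_congr
      intro a _
      rw [hA', AddMonoidHom.mem_ker]
    rw [h2]; omega
  have hmod' : Fintype.card A' % 3 = 1 := by omega
  have hA14 : 14 ≤ Fintype.card A' := by omega
  have h7 : 7 ≤ Fintype.card A' := by omega
  -- the mod-one law bound in `H`, and attainment
  have hle := tpp_volume_le_law_dihedralLike_mod_one hρρ' hρτ' hτρ' hττ' hρ'inj hτ'inj hne' hsurj' hmod' h7 htpp''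
  rw [cS'', cT'', cU''] at hle
  obtain ⟨k, hk⟩ : ∃ k, Fintype.card A' = 3 * k + 1 := ⟨Fintype.card A' / 3, by omega⟩
  have hdiv : 2 * Fintype.card A' / 3 = 2 * k := by rw [hk]; omega
  rw [hdiv] at hle
  have hV' : 3 * (S''.card * T''.card * U''.card) + 8 = 8 * Fintype.card A' := by
    rw [cS'', cT'', cU'']
    have h1 : S.card * T.card * U.card ≤ 2 * (S.card * T₀.card * U.card) := by
      have := Nat.mul_le_mul_left (S.card * U.card) hT₀card
      nlinarith [this]
    omega
  -- gen 8: `A'/⟨c₀⟩` is cyclic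
  obtain ⟨g, hg⟩ := quot_cyclic_of_mod_one_law_of_c0_ne_zero hρρ' hρτ' hτρ' hττ' hc₀'ne hρ'inj hτ'inj hne' hsurj'
    hmod' hA14 htpp'' hV'
  -- transfer to `A`: four cosets of `⟨g⟩`
  have hlift : ∀ y : A', y ∈ AddSubgroup.zmultiples g → (y : A) ∈ AddSubgroup.zmultiples (g : A) := by
    intro y hy
    obtain ⟨m, hm⟩ := AddSubgroup.mem_zmultiples_iff.1 hy
    exact AddSubgroup.mem_zmultiples_iff.2 ⟨m, by rw [← AddSubgroupClass.coe_zsmul, hm]⟩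
  have hcov : ∀ y : A, y ∈ AddSubgroup.zmultiples (g : A) ∨ y - a₁ ∈ AddSubgroup.zmultiples (g : A) ∨
      y + c₀ ∈ AddSubgroup.zmultiples (g : A) ∨ y + c₀ - a₁ ∈ AddSubgroup.zmultiples (g : A) := by
    intro y
    by_cases hy : φ y = 0
    · have hyA' : y ∈ A' := by rw [hA', AddMonoidHom.mem_ker]; exact hy
      rcases hg ⟨y, hyA'⟩ with h0 | h0
      · exact Or.inl (hlift _ h0)
      · exact Or.inr (Or.inr (Or.inl (hlift _ h0)))
    · have hy1 : φ y = 1 := zmod2_eq_one_of_ne_zero hy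
      have hyA' : y - a₁ ∈ A' := by rw [hA', AddMonoidHom.mem_ker, map_sub, hy1, ha₁, sub_self]
      rcases hg ⟨y - a₁, hyA'⟩ with h0 | h0
      · exact Or.inr (Or.inl (hlift _ h0))
      · refine Or.inr (Or.inr (Or.inr ?_))
        have := hlift _ h0
        have e1 : (((⟨y - a₁, hyA'⟩ : A') + c₀' : A') : A) = y + c₀ - a₁ := by
          show y - a₁ + c₀ = y + c₀ - a₁
          abel
        rwa [e1] at this
  exact h4 (g : A) a₁ hcov


/-- **Class P1 for quotients of `2`-rank `2` without a cyclic subgroup of index `≤ 2`**: two dominoes `S = {ρ s₀, τ s₁}`,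
`T = {ρ t₀, τ t₁}`; two homomorphisms `ψ₁, ψ₂ : A →+ ZMod 2` killing `c₀`, jointly onto `𝔽₂²`, give a non-zero `φ` killing
`(t₁ − t₀) − (s₁ − s₀)`, and `no_dicyclic_law_of_two_small'` (rotated to `(T, U, S)`) ends it. [folklore] -/
theorem no_dicyclic_law_of_two_domino_rank_two
    (hρρ : ∀ a b, ρ a * ρ b = ρ (a + b)) (hρτ : ∀ a b, ρ a * τ b = τ (b - a))
    (hτρ : ∀ a b, τ a * ρ b = τ (a + b)) (hττ : ∀ a b, τ a * τ b = ρ (c₀ + b - a)) (hc₀ : c₀ ≠ 0)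
    (hρ : Function.Injective ρ) (hτ : Function.Injective τ) (hne : ∀ a b, ρ a ≠ τ b)
    (hsurj : ∀ g, (∃ a, ρ a = g) ∨ (∃ a, τ a = g)) (hmod : Fintype.card A % 3 = 2) (hA : 28 ≤ Fintype.card A)
    (h4 : ∀ g z : A, ¬ ∀ y : A, y ∈ AddSubgroup.zmultiples g ∨ y - z ∈ AddSubgroup.zmultiples g ∨
      y + c₀ ∈ AddSubgroup.zmultiples g ∨ y + c₀ - z ∈ AddSubgroup.zmultiples g)
    (ψ₁ ψ₂ : A →+ ZMod 2) (hψc : ψ₁ c₀ = 0 ∧ ψ₂ c₀ = 0) (hψ : ∀ v : ZMod 2 × ZMod 2, ∃ y, (ψ₁ y, ψ₂ y) = v)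
    {S T U : Finset G} (h : TripleProductProperty S T U)
    {s₀ s₁ t₀ t₁ : A} (hS : S = {ρ s₀, τ s₁}) (hT : T = {ρ t₀, τ t₁}) :
    3 * (S.card * T.card * U.card) + 16 ≠ 8 * Fintype.card A := by
  intro hV
  have zmod2_eq_one_of_ne_zero : ∀ {z : ZMod 2}, z ≠ 0 → z = 1 := by decide
  have zmod2_one_add_one : (1 : ZMod 2) + 1 = 0 := by decide
  set d : A := t₁ - t₀ - (s₁ - s₀) with hd
  obtain ⟨φ, hφc, hφ, hφd⟩ : ∃ φ : A →+ ZMod 2, φ c₀ = 0 ∧ (∃ a, φ a ≠ 0) ∧ φ d = 0 := by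
    obtain ⟨y₁, hy₁⟩ := hψ (1, 0)
    obtain ⟨y₂, hy₂⟩ := hψ (0, 1)
    simp only [Prod.mk.injEq] at hy₁ hy₂
    by_cases h1 : ψ₁ d = 0
    · exact ⟨ψ₁, hψc.1, ⟨y₁, by rw [hy₁.1]; exact one_ne_zero⟩, h1⟩
    by_cases h2 : ψ₂ d = 0
    · exact ⟨ψ₂, hψc.2, ⟨y₂, by rw [hy₂.2]; exact one_ne_zero⟩, h2⟩
    refine ⟨ψ₁ + ψ₂, by rw [AddMonoidHom.add_apply, hψc.1, hψc.2, add_zero], ⟨y₁, ?_⟩, ?_⟩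
    · rw [AddMonoidHom.add_apply, hy₁.1, hy₁.2, add_zero]; exact one_ne_zero
    · rw [AddMonoidHom.add_apply, zmod2_eq_one_of_ne_zero h1, zmod2_eq_one_of_ne_zero h2, zmod2_one_add_one]
  -- rotate to `(T, U, S)` so that the two dominoes are first and third
  refine no_dicyclic_law_of_two_small' hρρ hρτ hτρ hττ hc₀ hρ hτ hne hsurj hmod hA h4 h.rotate
    (by rw [show T.card * U.card * S.card = S.card * T.card * U.card by ring]; exact hV) φ hφc hφ (s₁ - s₀) (φ t₀) (φ s₀)
    ?_ ?_ ?_ ?_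
  · intro a ha
    rw [hT, mem_insert, mem_singleton] at ha
    rcases ha with ha | ha
    · rw [hρ ha]
    · exact absurd ha (hne a t₁)
  · intro a ha
    rw [hT, mem_insert, mem_singleton] at ha
    rcases ha with ha | ha
    · exact absurd ha.symm (hne t₀ a)
    · rw [hτ ha]
      have : φ t₁ = φ t₀ + φ (s₁ - s₀) + φ d := by simp only [hd, map_sub]; abel
      rw [this, hφd, add_zero]
  · intro a ha
    rw [hS, mem_insert, mem_singleton] at ha
    rcases ha with ha | ha
    · rw [hρ ha]
    · exact absurd ha (hne a s₁)
  · intro a ha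
    rw [hS, mem_insert, mem_singleton] at ha
    rcases ha with ha | ha
    · exact absurd ha.symm (hne s₀ a)
    · rw [hτ ha, map_sub]; abel

end Restriction

end Summit.MatrixMultiplication.OmegaCensus
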